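import Literature.MathematicalPhysics.QuantumFieldTheory.Balaban1983to89.B11Eq26ActionExpansion
import Literature.MathematicalPhysics.QuantumFieldTheory.Balaban1983to89.B11Eq85FirstDerivative

/-!
# `Balaban1983to89.B11Eq90V0Derivative` — T. Bałaban, *The variational problem and background fields in renormalization group method for lattice gauge theories*, Commun. Math. Phys. **102** (1985) 277–309 [Balaban1985Variational]: p. 291, the sentence under (90) — «The derivative ((∂/∂A(b))V′₀)(A, ∂p) satisfies a bound similar to the bound (40) for the function V′₀(A, ∂p), but with the power of |A| lower by 1, and with a different absolute constant» — PROVED, by Cauchy's estimate on complex lines, for the genuine per-plaquette remainder `V₀(A, ∂p)` of `B11Eq26ActionExpansion` (an entire function of `A`, p. 282) and for every entire function majorised by the (40) majorant; junction with the (90) bookkeeping `B11Eq85FirstDerivative.ineq90` BY NAME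

statement-level skeleton of published theorems with citation tags; proofs where landed; nothing here is a claim about the Yang–Mills mass gap

PDF held: `paper:balaban1985-cmp102-variational-background` (journal page = PDF page + 276); pp. 282, 284, 287, 291 read by this seat from the
`lit read` text layer, displays cross-checked against the tree's render-read transcriptions in `B11Eq26ActionExpansion` ((26), (29)–(31)),
`B11Eq37NormBound` ((39)–(40)), `B11Eq63FunctionalDerivative` ((63)), `B11Eq85FirstDerivative` ((90)).

CITATION HEADER (lean-in-tree rule 2026-08-18).  WHAT IS REPRODUCED: one printed SENTENCE of the proof of Proposition 4 (the
(90)-group of the termwise estimates of `(δ/δA′)V`, row `B11.Eq85` of reader r08's `ROWS-B11.md`), read as a theorem about the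
objects ALREADY IN THE TREE: `B11Eq26ActionExpansion.V0p T U η τ A μ ν x` (= `V₀(A, ∂p)` of (30), `η⁻⁴ ×` [5]'s third-order
remainder `B9Eq39Adjoint.rem3`), `B11Eq26ActionExpansion.V0` (= `V₀(A)` of (26)), the letters `B9Eq39Adjoint.lettersA` (`A′(b)`,
`b ⊂ ∂p`) and their size `Beta.TransportVertices.size` (= `|A|(∂p) := Σ_{b⊂∂p}|A′(b)|`).

THE PRINT, verbatim.  p. 282: *«The action A(U₁U₀) is an analytic, and even an entire function of A for A ∈ 𝔤ᶜ, or for A in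
the space of all complex N × N matrices, so V₀(A) is such a function also. We need a bound for V₀(A).»*  p. 284 (40), first member
(as certified in `B11Eq37NormBound.ineq40_first`): *«|V′₀(A, ∂p)| ≦ (|A|(∂p))³ηC₁B₃ε₁(Lʲη)⁻² + (2/4!)(|A|(∂p))⁴»*.  p. 287 (63): *«The
functional derivative is a kernel of the linear operator acting on functions δA′ and defined as ⟨(δ/δA′)D(A′), δA′⟩ =
(d/dτ)D(A′ + τδA′)|_{τ=0}.»*  p. 291 (90) and the sentence proved here (transcription as in `B11Eq85FirstDerivative`, render-read
there): *«We have (δ/δA′(b)) V′₀(A′ − HD(A′)) = Σ_{p∈st(b)} ((∂/∂A(b))V′₀)(A′ − HD(A′), ∂p) − 𝔇*(A′)H* Σ_{p∈st(·)} ((∂/∂A(·))V′₀)(A′ −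
HD(A′), ∂p), (90) where st(b) denotes a set of plaquettes p such that b ⊂ ∂p. The derivative ((∂/∂A(b))V′₀)(A, ∂p) satisfies a bound
similar to the bound (40) for the function V′₀(A, ∂p), but with the power of |A| lower by 1, and with a different absolute constant.
This implies that the functional derivative (90) can be estimated by O(1)ε₃²(ε₁ + ε₃)(Lʲη)⁻³ on Ω_j.»*

THE MECHANISM (print gives none; this file's): `V₀(A, ∂p)` is ENTIRE in `A` (p. 282), so `g(t) = V₀(A + tδA, ∂p)` is entire in
`t ∈ ℂ`; along the line `|A + tδA|(∂p) ≦ |A|(∂p) + |t||δA|(∂p) ≦ s + |t|Δ`, so a monotone majorant `|V(·, ∂p)| ≦ M(|·|(∂p))` gives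
`|g(t)| ≦ M(s + rΔ)` on `|t| = r` and CAUCHY'S ESTIMATE (Mathlib `Complex.norm_deriv_le_of_forall_mem_sphere_norm_le`) gives
`|g′(0)| ≦ M(s + rΔ)/r`; the radius `r = s/Δ` yields `Δ·M(2s)/s` — for `M(u) = Kuⁿe^{cu}` this is `2ⁿK·s^{n−1}e^{2cs}·Δ`: THE SAME
BOUND WITH THE POWER OF `|A|` LOWER BY ONE AND A DIFFERENT ABSOLUTE CONSTANT.  `g′(0)` IS (63)'s functional derivative applied to `δA`.

WHAT IS CERTIFIED (kernel, sorry-free; axioms `propext` / `Classical.choice` / `Quot.sound`).  Carrier: [5]'s abstract finite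
lattice of `B9Eq39Adjoint` / `B11Eq26ActionExpansion` (sites `S`, directions `ι`, bijective shifts `T`, background units `U`,
complete normed `ℂ`-algebra `𝔸`, continuous linear `τ`).
§1 (p. 282) `differentiable_rem3`, **`differentiable_V0p`**, **`differentiable_V0`** (`A ↦ V₀(A, ∂p)`, `A ↦ V₀(A)` are `ℂ`-differentiable
   on the whole configuration space `ι → S → 𝔸`); `deriv_V0p_line_eq_fderiv` ((63): `(d/dt)V₀(A + tδA, ∂p)|₀ = (DV₀(·, ∂p))(A)·δA`).
§2 `size_lettersA_add_smul_le` (`|A + tδA|(∂p) ≦ |A|(∂p) + |t||δA|(∂p)`), `norm_V0p_line_le` (`B11Eq26ActionExpansion.norm_V0p_le`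
   along the line).
§3 **THE SENTENCE FOR `V₀(A, ∂p)`**: `norm_deriv_V0p_line_le_div` (every radius `r`: `|∂_{δA}V₀(A, ∂p)| ≦ η⁻⁴κ_p·T₃(η(s + rΔ))/r`,
   `κ_p = ½‖τ‖(‖U₀(∂p)‖ + ‖U₀(∂p)⁻¹‖)`, `T₃(u) = eᵘ − 1 − u − u²/2`) and **`norm_deriv_V0p_line_le_sq`** (`r = s/Δ`):
   `|∂_{δA}V₀(A, ∂p)| ≦ (4/3)κ_p η⁻¹s²e^{2ηs}·Δ` for `|A|(∂p) ≦ s`, `|δA|(∂p) ≦ Δ` — against `norm_V0p_le_cubic`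
   `|V₀(A, ∂p)| ≦ κ_p η⁻¹(s³/6)e^{ηs}`: power of `|A|` lower by one, constant `1/6 ↦ 4/3`, `e^{ηs} ↦ e^{2ηs}`.
§4 **THE STRUCTURE OF (90), first display** (for `V₀`): `deriv_V0_line_eq_sum` (`∂_{δA}V₀(A) = η^d Σ_p ∂_{δA}V₀(A, ∂p)`, from (30)),
   `deriv_V0p_line_eq_zero` (a plaquette whose boundary letters are blind to `δA` contributes `0`), **`deriv_V0_line_eq_sum_of_subset`**
   (the sum localises to any set of plaquettes `P ⊇ st(supp δA)`), **`norm_deriv_V0_line_le`** (`|∂_{δA}V₀(A)| ≦ η^d·#P·(4/3)κη⁻¹s²e^{2ηs}Δ`).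
§5 **THE SENTENCE AS PRINTED, FOR `V′₀`, THROUGH THE (40) MAJORANT**: `norm_deriv_le_of_majorant40` — ANY entire `g : ℂ → F` with
   `‖g(t)‖ ≦ (s + |t|Δ)³ηκ + (2/4!)(s + |t|Δ)⁴` on the circle `|t| = s/Δ` (the first member of (40) there) has `‖g′(0)‖ ≦ Δ(8s²ηκ + (4/3)s³)` — (40) with
   the power of `|A|` lower by 1 and the constants `(1, 2/4!) ↦ (8, 4/3)`; **`hg90_of_deriv40`**: with `|A|(∂p) ≦ 4|A| = 4x`,
   `η ≦ Lʲη = t`, `κ = C₁B₃ε₁t⁻²` this is EXACTLY the hypothesis `hg : g ≦ K₀x²(C₁B₃ε₁ + tx)/t` of `B11Eq85FirstDerivative.ineq90` with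
   `K₀ = 128Δ`, and **`ineq90_of_deriv40`** closes (90)'s «O(1)ε₃²(ε₁ + ε₃)(Lʲη)⁻³» from it BY NAME.

HONEST SCOPE — what is NOT claimed.  (i) §3–§4 concern `V₀(A, ∂p)` (the whole third-order remainder, unconditionally bounded in the
tree by `norm_V0p_le`) and inherit that bound's bare factor `η⁻¹` (`κ_p η⁻¹ s³`): CORRECT BUT NOT η-UNIFORM — print splits `V₀` by (39)
precisely so that `V′₀` obeys (40) (`S³ηκ + (2/4!)S⁴`, no `η⁻¹`; the `(DA)(p)`-term goes to (91)–(96) with `|∇A′|₍₋₂₎`); the printed sentence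
is about `V′₀`, whose (40) majorant holds under the trace-slot / background hypotheses of `B11Eq37NormBound.ineq40_first` — §5 takes that
majorant ON THE CIRCLE of the complex line as a hypothesis (`h40`) and proves the derivative form (this is the η-uniform statement (90) uses); discharging `h40` at complex configurations is the reader's, exactly as (40) itself is in r08's file (the tree's
(36) `B11Eq26ActionExpansion.V3p_eq_eq36` is stated for Hermitian `A`; both sides being entire in `A`, it extends to all of 𝔤ᶜ by
the identity theorem — not typed here).  (ii) The
composition with the Sect. C map `A′ ↦ A′ − HD(A′)` and the operator `𝔇*(A′)H*` of (90)'s second sum are NOT touched (they enter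
`ineq90` as the count `n = #st(b)` and the operator bound `θ`).  (iii) `|·|(∂p)`, `|·|` are [5]'s / this tree's abstract sizes
(`size (lettersA …)`, majorants `s`, `x`); the identification with `T_η ∩ Ω_j`, the normalized matrix trace, `#st(b) = 2(d − 1)` and the
weights `(Lʲη)` is the reader's (DIVERGENCE D-pv27.4 inherited).  (iv) `4/3`, `8`, `128` are explicit witnesses of print's «different
absolute constant» / «O(1)» from the radius choice `r = s/Δ` (not optimal).  (v) Nothing of Propositions 3–9, Theorem 1, (B) UV
stability or any summit statement is asserted.  No `def`, no new named fact; theorem-only module.  Unit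
`b2b-balaban-t4-ne9-formalise-leaf-05` (cell `pub-balaban`, NE9 crux-team leaf prover, gen 63; the V₀-group is the inner analytic content
of the (90) leaf `est90` of `B11Prop4Assembly.TermwiseDatum` = letter (L3) `W = (δ/δA′)V` of the NE9 letter map, WALL-NE9-P1 §2).  Imports
`B11Eq26ActionExpansion`, `B11Eq85FirstDerivative` (r08) ONLY; modifies nothing there.
-/

noncomputable section

open NormedSpace Complex Metric Set Finset

namespace Literature.MathematicalPhysics.QuantumFieldTheory.Balaban1983to89.B11Eq90V0Derivative

open Literature.MathematicalPhysics.QuantumFieldTheory.Balaban1983to89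
open Literature.MathematicalPhysics.QuantumFieldTheory.Balaban1983to89.Beta.TransportVertices
open Literature.MathematicalPhysics.QuantumFieldTheory.Balaban1983to89.Beta.AdjointTransportJets
open Literature.MathematicalPhysics.QuantumFieldTheory.Balaban1983to89.B9Eq37Insertion
open Literature.MathematicalPhysics.QuantumFieldTheory.Balaban1983to89.B9Eq39Adjoint
open Literature.MathematicalPhysics.QuantumFieldTheory.Balaban1983to89.B11Eq26ActionExpansion

/-! ## §1 «An analytic, and even an entire function of A» (p. 282): differentiability of `V₀(A, ∂p)`, `V₀(A)` in `A` -/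

variable {𝔸 : Type*} [NormedRing 𝔸] [NormedAlgebra ℂ 𝔸] [CompleteSpace 𝔸]

/-- `exp` is `ℂ`-differentiable on a complete normed `ℂ`-algebra (Mathlib: analytic). [folklore] [cite: Balaban1985Variational, p.282] -/
theorem differentiable_expAlgebra : Differentiable ℂ (fun X : 𝔸 => exp X) :=
  fun X => (NormedSpace.exp_analytic (𝕂 := ℂ) X).differentiableAt

omit [CompleteSpace 𝔸] in
/-- The transport `X ↦ R(U₀(b))X = U₀XU₀⁻¹` is `ℂ`-differentiable. [folklore] [cite: Balaban1985Variational, (25) p.282] -/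
theorem differentiable_R (V : 𝔸ˣ) : Differentiable ℂ (fun X : 𝔸 => R V X) := by
  unfold R; fun_prop

/-- The third-order remainder `Πe^{Yᵢ} − 1 − ΣYᵢ − quad` of FOUR differentiable letters is differentiable (product of exponentials
minus a polynomial). [folklore] [cite: Balaban1985Variational, (34)-(35) p.283] -/
theorem differentiable_rem_four {E : Type*} [NormedAddCommGroup E] [NormedSpace ℂ E] {a b c d : E → 𝔸}
    (ha : Differentiable ℂ a) (hb : Differentiable ℂ b) (hc : Differentiable ℂ c) (hd : Differentiable ℂ d) :
    Differentiable ℂ (fun Y => rem [a Y, b Y, c Y, d Y]) := by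
  have hexp := differentiable_expAlgebra (𝔸 := 𝔸)
  simp only [rem, holonomy_cons, holonomy_nil, List.sum_cons, List.sum_nil, quad_cons, quad_nil, mul_one, add_zero]
  fun_prop

variable {S : Type*} [Fintype S] {ι : Type*} [Fintype ι] [LinearOrder ι]
variable (T : ι → Equiv.Perm S) (U : ι → S → 𝔸ˣ)

omit [LinearOrder ι] in
/-- [5]'s per-plaquette third-order remainder `ρ_p(A)` (`B9Eq39Adjoint.rem3`) is an ENTIRE function of the configuration `A`
(p. 282: «A(U₁U₀) is an analytic, and even an entire function of A … so V₀(A) is such a function also»).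
[cite: Balaban1985Variational, p.282] -/
theorem differentiable_rem3 (η : ℝ) (τ : 𝔸 →L[ℂ] ℂ) (μ ν : ι) (x : S) :
    Differentiable ℂ (fun A : ι → S → 𝔸 => rem3 T U η (τ : 𝔸 →ₗ[ℂ] ℂ) A μ ν x) := by
  have hR1 := differentiable_R (U ν x)
  have hR2 := differentiable_R (U μ x)
  unfold rem3
  simp only [lettersA, letters, List.map_cons, List.map_nil, invPath_four]
  have h1 : Differentiable ℂ (fun A : ι → S → 𝔸 =>
      rem [(I * ↑η) • -R (U ν x) (A μ ((T ν) x)), (I * ↑η) • -A ν x, (I * ↑η) • A μ x,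
        (I * ↑η) • R (U μ x) (A ν ((T μ) x))]) := by
    apply differentiable_rem_four <;> fun_prop
  have h2 : Differentiable ℂ (fun A : ι → S → 𝔸 =>
      rem [-((I * ↑η) • R (U μ x) (A ν ((T μ) x))), -((I * ↑η) • A μ x), -((I * ↑η) • -A ν x),
        -((I * ↑η) • -R (U ν x) (A μ ((T ν) x)))]) := by
    apply differentiable_rem_four <;> fun_prop
  have hτ : Differentiable ℂ (fun X : 𝔸 => (τ : 𝔸 →ₗ[ℂ] ℂ) X) := τ.differentiable
  fun_prop

omit [LinearOrder ι] in
/-- **`V₀(A, ∂p)` IS AN ENTIRE FUNCTION OF `A`** (p. 282), for the tree's `B11Eq26ActionExpansion.V0p`.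
[cite: Balaban1985Variational, p.282, (30) p.282] -/
theorem differentiable_V0p (η : ℝ) (τ : 𝔸 →L[ℂ] ℂ) (μ ν : ι) (x : S) :
    Differentiable ℂ (fun A : ι → S → 𝔸 => V0p T U η (τ : 𝔸 →ₗ[ℂ] ℂ) A μ ν x) := by
  unfold V0p
  exact (differentiable_rem3 T U η τ μ ν x).const_mul _

/-- **`V₀(A)` IS AN ENTIRE FUNCTION OF `A`** (p. 282: «so V₀(A) is such a function also»), for the tree's `B11Eq26ActionExpansion.V0`
(via (30) `eq30a`: `V₀(A) = Σ_p η^d V₀(A, ∂p)`; tracial `τ`, `η ≠ 0`, `d ≧ 4` as there). [cite: Balaban1985Variational, p.282, (26) p.282] -/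
theorem differentiable_V0 (τ : 𝔸 →L[ℂ] ℂ) (hτ : ∀ a b : 𝔸, τ (a * b) = τ (b * a)) (η : ℝ) (hη : η ≠ 0) {d : ℕ}
    (hd : 4 ≤ d) : Differentiable ℂ (fun A : ι → S → 𝔸 => V0 T U η d (τ : 𝔸 →ₗ[ℂ] ℂ) A) := by
  have e : (fun A : ι → S → 𝔸 => V0 T U η d (τ : 𝔸 →ₗ[ℂ] ℂ) A)
      = fun A => ∑ q ∈ posPlaq S ι, (η : ℂ) ^ d * V0p T U η (τ : 𝔸 →ₗ[ℂ] ℂ) A q.2.1 q.2.2 q.1 := by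
    funext A; exact eq30a T U (τ : 𝔸 →ₗ[ℂ] ℂ) hτ η hη hd A
  rw [e]
  refine Differentiable.fun_sum fun q _ => ?_
  exact (differentiable_V0p T U η τ q.2.1 q.2.2 q.1).const_mul _

omit [LinearOrder ι] in
/-- The restriction of `V₀(·, ∂p)` to a complex line `t ↦ A + tδA` is entire in `t`. [cite: Balaban1985Variational, p.282, (63) p.287] -/
theorem differentiable_V0p_line (η : ℝ) (τ : 𝔸 →L[ℂ] ℂ) (A δ : ι → S → 𝔸) (μ ν : ι) (x : S) :
    Differentiable ℂ (fun t : ℂ => V0p T U η (τ : 𝔸 →ₗ[ℂ] ℂ) (A + t • δ) μ ν x) :=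
  (differentiable_V0p T U η τ μ ν x).comp (by fun_prop)

/-- **(63)**: the directional derivative along `δA` IS the Fréchet derivative applied to `δA`, `(d/dt)Φ(A + tδA)|_{t=0} = (DΦ)(A)·δA`
(«⟨(δ/δA′)D(A′), δA′⟩ = (d/dτ)D(A′ + τδA′)|_{τ=0}»). [folklore] [cite: Balaban1985Variational, (63) p.287] -/
theorem deriv_line_eq_fderiv {E F : Type*} [NormedAddCommGroup E] [NormedSpace ℂ E] [NormedAddCommGroup F]
    [NormedSpace ℂ F] {Φ : E → F} {A : E} (hΦ : DifferentiableAt ℂ Φ A) (δ : E) :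
    deriv (fun t : ℂ => Φ (A + t • δ)) 0 = fderiv ℂ Φ A δ := by
  have hline : HasDerivAt (fun t : ℂ => A + t • δ) δ 0 := by
    simpa using ((hasDerivAt_id (0 : ℂ)).smul_const δ).const_add A
  have hΦ' : DifferentiableAt ℂ Φ (A + (0 : ℂ) • δ) := by simpa using hΦ
  have h := hΦ'.hasFDerivAt.comp_hasDerivAt (0 : ℂ) hline
  rw [zero_smul, add_zero] at h
  exact h.deriv

omit [LinearOrder ι] in
/-- (63) FOR `V₀(·, ∂p)`: `(d/dt)V₀(A + tδA, ∂p)|_{t=0} = (DV₀(·, ∂p))(A)·δA` — the quantity bounded in §3 is print's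
`((∂/∂A)V₀)(A, ∂p)` applied to the variation `δA`. [cite: Balaban1985Variational, (63) p.287, (90) p.291] -/
theorem deriv_V0p_line_eq_fderiv (η : ℝ) (τ : 𝔸 →L[ℂ] ℂ) (A δ : ι → S → 𝔸) (μ ν : ι) (x : S) :
    deriv (fun t : ℂ => V0p T U η (τ : 𝔸 →ₗ[ℂ] ℂ) (A + t • δ) μ ν x) 0
      = fderiv ℂ (fun B : ι → S → 𝔸 => V0p T U η (τ : 𝔸 →ₗ[ℂ] ℂ) B μ ν x) A δ :=
  deriv_line_eq_fderiv ((differentiable_V0p T U η τ μ ν x) A) δ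

/-! ## §2 The size of the letters along a line -/

omit [NormedAlgebra ℂ 𝔸] [CompleteSpace 𝔸] [Fintype S] [Fintype ι] [LinearOrder ι] in
/-- `|A|(∂p) = Σ_{b⊂∂p}|A′(b)|` spelled out on the four letters of `B9Eq39Adjoint.lettersA`.
[cite: Balaban1985Variational, (31) p.282, (25) p.282] -/
theorem size_lettersA (A : ι → S → 𝔸) (μ ν : ι) (x : S) :
    size (lettersA T U A μ ν x)
      = ‖R (U ν x) (A μ (T ν x))‖ + ‖A ν x‖ + ‖A μ x‖ + ‖R (U μ x) (A ν (T μ x))‖ := by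
  simp [lettersA, size, norm_neg]
  ring

omit [CompleteSpace 𝔸] [Fintype S] [Fintype ι] [LinearOrder ι] in
/-- ALONG A COMPLEX LINE the size grows at most linearly: `|A + tδA|(∂p) ≦ |A|(∂p) + |t|·|δA|(∂p)` (the letters are `ℂ`-linear in
the configuration). [cite: Balaban1985Variational, (25) p.282, (63) p.287] -/
theorem size_lettersA_add_smul_le (A δ : ι → S → 𝔸) (t : ℂ) (μ ν : ι) (x : S) :
    size (lettersA T U (A + t • δ) μ ν x)
      ≤ size (lettersA T U A μ ν x) + ‖t‖ * size (lettersA T U δ μ ν x) := by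
  rw [size_lettersA, size_lettersA, size_lettersA]
  simp only [Pi.add_apply, Pi.smul_apply, R_add, R_smul]
  have n1 := norm_add_le (R (U ν x) (A μ (T ν x))) (t • R (U ν x) (δ μ (T ν x)))
  have n2 := norm_add_le (A ν x) (t • δ ν x)
  have n3 := norm_add_le (A μ x) (t • δ μ x)
  have n4 := norm_add_le (R (U μ x) (A ν (T μ x))) (t • R (U μ x) (δ ν (T μ x)))
  simp only [norm_smul] at n1 n2 n3 n4
  nlinarith [norm_nonneg t]

omit [Fintype S] [Fintype ι] [LinearOrder ι] in
/-- THE CUBIC BOUND ALONG THE LINE: for `|A|(∂p) ≦ s`, `|δA|(∂p) ≦ Δ`,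
`|V₀(A + tδA, ∂p)| ≦ η⁻⁴·½‖τ‖(‖U₀(∂p)‖ + ‖U₀(∂p)⁻¹‖)·T₃(|η|(s + |t|Δ))` (`B11Eq26ActionExpansion.norm_V0p_le` + monotonicity of
`T₃ = expTail 3`). [cite: Balaban1985Variational, (30)-(31) p.282] -/
theorem norm_V0p_line_le (τ : 𝔸 →L[ℂ] ℂ) (η : ℝ) (A δ : ι → S → 𝔸) (μ ν : ι) (x : S) {s Δ : ℝ}
    (hs : size (lettersA T U A μ ν x) ≤ s) (hΔ : size (lettersA T U δ μ ν x) ≤ Δ) (t : ℂ) :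
    ‖V0p T U η (τ : 𝔸 →ₗ[ℂ] ℂ) (A + t • δ) μ ν x‖
      ≤ (|η|⁻¹) ^ 4 * (2⁻¹ * ‖τ‖ * (‖(plaqU T U μ ν x : 𝔸)‖ + ‖(((plaqU T U μ ν x)⁻¹ : 𝔸ˣ) : 𝔸)‖)
          * expTail 3 (|η| * (s + ‖t‖ * Δ))) := by
  refine (norm_V0p_le T U τ η (A + t • δ) μ ν x).trans ?_
  have hΔ0 : 0 ≤ Δ := (size_nonneg _).trans hΔ
  have hsz : size (lettersA T U (A + t • δ) μ ν x) ≤ s + ‖t‖ * Δ :=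
    (size_lettersA_add_smul_le T U A δ t μ ν x).trans (by gcongr)
  gcongr
  exact expTail_mono 3 (mul_nonneg (abs_nonneg η) (size_nonneg _)) (by gcongr)

/-! ## §3 The sentence for `V₀(A, ∂p)`: the derivative obeys the bound of the function with the power of `|A|` lower by one -/

omit [LinearOrder ι] in
/-- **CAUCHY'S ESTIMATE FOR `∂_{δA}V₀(A, ∂p)`**, every radius: for `|A|(∂p) ≦ s`, `|δA|(∂p) ≦ Δ` and `r > 0`,
`|(d/dt)V₀(A + tδA, ∂p)|_{t=0}| ≦ η⁻⁴·½‖τ‖(‖U₀(∂p)‖ + ‖U₀(∂p)⁻¹‖)·T₃(|η|(s + rΔ)) / r`.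
[cite: Balaban1985Variational, (90) p.291, (63) p.287] -/
theorem norm_deriv_V0p_line_le_div (τ : 𝔸 →L[ℂ] ℂ) (η : ℝ) (A δ : ι → S → 𝔸) (μ ν : ι) (x : S) {s Δ : ℝ}
    (hs : size (lettersA T U A μ ν x) ≤ s) (hΔ : size (lettersA T U δ μ ν x) ≤ Δ) {r : ℝ} (hr : 0 < r) :
    ‖deriv (fun t : ℂ => V0p T U η (τ : 𝔸 →ₗ[ℂ] ℂ) (A + t • δ) μ ν x) 0‖
      ≤ (|η|⁻¹) ^ 4 * (2⁻¹ * ‖τ‖ * (‖(plaqU T U μ ν x : 𝔸)‖ + ‖(((plaqU T U μ ν x)⁻¹ : 𝔸ˣ) : 𝔸)‖)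
          * expTail 3 (|η| * (s + r * Δ))) / r := by
  refine Complex.norm_deriv_le_of_forall_mem_sphere_norm_le hr
    (differentiable_V0p_line T U η τ A δ μ ν x).diffContOnCl fun z hz => ?_
  rw [mem_sphere_zero_iff_norm] at hz
  simpa only [hz] using norm_V0p_line_le T U τ η A δ μ ν x hs hΔ z

omit [LinearOrder ι] in
/-- **THE SENTENCE'S FORM FOR `V₀(A, ∂p)`** (radius `r = s/Δ`): for `0 < η`, `|A|(∂p) ≦ s`, `|δA|(∂p) ≦ Δ`, `0 < s`, `0 < Δ`,
`|(d/dt)V₀(A + tδA, ∂p)|_{t=0}| ≦ (4/3)·½‖τ‖(‖U₀(∂p)‖ + ‖U₀(∂p)⁻¹‖)·η⁻¹·s²·e^{2ηs}·Δ` — against the bound of the function itself,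
`|V₀(A, ∂p)| ≦ ½‖τ‖(‖U₀(∂p)‖ + ‖U₀(∂p)⁻¹‖)·η⁻¹·(s³/6)·e^{ηs}` (`B11Eq26ActionExpansion.norm_V0p_le_cubic`): «… with the power of |A| lower
by 1, and with a different absolute constant» (CRUDE: the bare `η⁻¹` of the cubic bound is inherited; the η-uniform form for `V′₀` is §5).
[cite: Balaban1985Variational, (90) p.291, (31) p.282] -/
theorem norm_deriv_V0p_line_le_sq (τ : 𝔸 →L[ℂ] ℂ) {η : ℝ} (hη : 0 < η) (A δ : ι → S → 𝔸) (μ ν : ι) (x : S)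
    {s Δ : ℝ} (hs : size (lettersA T U A μ ν x) ≤ s) (hΔ : size (lettersA T U δ μ ν x) ≤ Δ) (hs0 : 0 < s)
    (hΔ0 : 0 < Δ) :
    ‖deriv (fun t : ℂ => V0p T U η (τ : 𝔸 →ₗ[ℂ] ℂ) (A + t • δ) μ ν x) 0‖
      ≤ 4 / 3 * (2⁻¹ * ‖τ‖ * (‖(plaqU T U μ ν x : 𝔸)‖ + ‖(((plaqU T U μ ν x)⁻¹ : 𝔸ˣ) : 𝔸)‖))
          * η⁻¹ * s ^ 2 * Real.exp (2 * η * s) * Δ := by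
  set κ : ℝ := 2⁻¹ * ‖τ‖ * (‖(plaqU T U μ ν x : 𝔸)‖ + ‖(((plaqU T U μ ν x)⁻¹ : 𝔸ˣ) : 𝔸)‖) with hκ
  have hr : 0 < s / Δ := div_pos hs0 hΔ0
  have h := norm_deriv_V0p_line_le_div T U τ η A δ μ ν x hs hΔ hr
  have e1 : s + s / Δ * Δ = 2 * s := by rw [div_mul_cancel₀ s hΔ0.ne']; ring
  rw [e1, abs_of_pos hη] at h
  have h2s : 0 ≤ η * (2 * s) := by positivity
  have hT := expTail_three_le h2s
  refine h.trans ?_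
  rw [div_le_iff₀ hr]
  calc (η⁻¹) ^ 4 * (κ * expTail 3 (η * (2 * s)))
      ≤ (η⁻¹) ^ 4 * (κ * ((η * (2 * s)) ^ 3 / 6 * Real.exp (η * (2 * s)))) := by gcongr
    _ = 4 / 3 * κ * η⁻¹ * s ^ 2 * Real.exp (2 * η * s) * Δ * (s / Δ) := by
        field_simp
        ring

/-! ## §4 The structure of (90), first display: `∂_{δA}V₀(A) = η^d Σ_{p∈st(supp δA)} ∂_{δA}V₀(A, ∂p)` -/

/-- `∂_{δA}V₀(A) = η^d Σ_p ∂_{δA}V₀(A, ∂p)` (differentiate (30) `V₀(A) = Σ_p η^d V₀(A, ∂p)` term by term).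
[cite: Balaban1985Variational, (90) p.291, (30) p.282] -/
theorem deriv_V0_line_eq_sum (τ : 𝔸 →L[ℂ] ℂ) (hτ : ∀ a b : 𝔸, τ (a * b) = τ (b * a)) {η : ℝ} (hη : η ≠ 0) {d : ℕ}
    (hd : 4 ≤ d) (A δ : ι → S → 𝔸) :
    deriv (fun t : ℂ => V0 T U η d (τ : 𝔸 →ₗ[ℂ] ℂ) (A + t • δ)) 0
      = (η : ℂ) ^ d * ∑ q ∈ posPlaq S ι, deriv (fun t : ℂ => V0p T U η (τ : 𝔸 →ₗ[ℂ] ℂ) (A + t • δ) q.2.1 q.2.2 q.1) 0 := by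
  have e : (fun t : ℂ => V0 T U η d (τ : 𝔸 →ₗ[ℂ] ℂ) (A + t • δ))
      = fun t => ∑ q ∈ posPlaq S ι, (η : ℂ) ^ d * V0p T U η (τ : 𝔸 →ₗ[ℂ] ℂ) (A + t • δ) q.2.1 q.2.2 q.1 := by
    funext t; exact eq30a T U (τ : 𝔸 →ₗ[ℂ] ℂ) hτ η hη hd (A + t • δ)
  have hq : ∀ q ∈ posPlaq S ι, HasDerivAt
      (fun t : ℂ => (η : ℂ) ^ d * V0p T U η (τ : 𝔸 →ₗ[ℂ] ℂ) (A + t • δ) q.2.1 q.2.2 q.1)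
      ((η : ℂ) ^ d * deriv (fun t : ℂ => V0p T U η (τ : 𝔸 →ₗ[ℂ] ℂ) (A + t • δ) q.2.1 q.2.2 q.1) 0) 0 :=
    fun q _ => ((differentiable_V0p_line T U η τ A δ q.2.1 q.2.2 q.1) 0).hasDerivAt.const_mul _
  rw [e, (HasDerivAt.fun_sum hq).deriv, Finset.mul_sum]

omit [CompleteSpace 𝔸] [Fintype S] [Fintype ι] [LinearOrder ι] in
/-- A plaquette whose boundary letters do not see `δA` (`A′(b)[δA] = 0` for the four `b ⊂ ∂p`, i.e. `p ∉ st(supp δA)`) has the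
same letters along the whole line `A + tδA`. [cite: Balaban1985Variational, (90) p.291] -/
theorem lettersA_add_smul_of_letters_zero {A δ : ι → S → 𝔸} {μ ν : ι} {x : S}
    (hδ : lettersA T U δ μ ν x = [0, 0, 0, 0]) (t : ℂ) :
    lettersA T U (A + t • δ) μ ν x = lettersA T U A μ ν x := by
  simp only [lettersA, List.cons.injEq, neg_eq_zero, and_true] at hδ
  obtain ⟨h1, h2, h3, h4⟩ := hδ
  simp only [lettersA, Pi.add_apply, Pi.smul_apply, R_add, R_smul, h1, h2, h3, h4, smul_zero, add_zero]

omit [CompleteSpace 𝔸] [Fintype S] [Fintype ι] [LinearOrder ι] in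
/-- … hence `V₀(A + tδA, ∂p) = V₀(A, ∂p)` for all `t` … [cite: Balaban1985Variational, (90) p.291] -/
theorem V0p_add_smul_of_letters_zero (η : ℝ) (τ : 𝔸 →ₗ[ℂ] ℂ) {A δ : ι → S → 𝔸} {μ ν : ι} {x : S}
    (hδ : lettersA T U δ μ ν x = [0, 0, 0, 0]) (t : ℂ) :
    V0p T U η τ (A + t • δ) μ ν x = V0p T U η τ A μ ν x := by
  simp only [V0p, rem3, lettersA_add_smul_of_letters_zero T U hδ t]

omit [CompleteSpace 𝔸] [Fintype S] [Fintype ι] [LinearOrder ι] in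
/-- … and contributes `0` to the derivative: only the plaquettes of `st(supp δA)` («st(b) denotes a set of plaquettes p such that
b ⊂ ∂p») enter (90). [cite: Balaban1985Variational, (90) p.291] -/
theorem deriv_V0p_line_eq_zero (η : ℝ) (τ : 𝔸 →ₗ[ℂ] ℂ) {A δ : ι → S → 𝔸} {μ ν : ι} {x : S}
    (hδ : lettersA T U δ μ ν x = [0, 0, 0, 0]) :
    deriv (fun t : ℂ => V0p T U η τ (A + t • δ) μ ν x) 0 = 0 := by
  simp only [V0p_add_smul_of_letters_zero T U η τ hδ, deriv_const]

/-- **(90), FIRST DISPLAY, FOR `V₀`**: if every plaquette outside `P` has boundary letters blind to `δA` (`P ⊇ st(supp δA)`, `P` a set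
of positively oriented plaquettes), then `∂_{δA}V₀(A) = η^d Σ_{p∈P} ∂_{δA}V₀(A, ∂p)`. [cite: Balaban1985Variational, (90) p.291] -/
theorem deriv_V0_line_eq_sum_of_subset (τ : 𝔸 →L[ℂ] ℂ) (hτ : ∀ a b : 𝔸, τ (a * b) = τ (b * a)) {η : ℝ} (hη : η ≠ 0)
    {d : ℕ} (hd : 4 ≤ d) (A δ : ι → S → 𝔸) {P : Finset (S × ι × ι)} (hPsub : P ⊆ posPlaq S ι)
    (hP : ∀ q ∈ posPlaq S ι, q ∉ P → lettersA T U δ q.2.1 q.2.2 q.1 = [0, 0, 0, 0]) :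
    deriv (fun t : ℂ => V0 T U η d (τ : 𝔸 →ₗ[ℂ] ℂ) (A + t • δ)) 0
      = (η : ℂ) ^ d * ∑ q ∈ P, deriv (fun t : ℂ => V0p T U η (τ : 𝔸 →ₗ[ℂ] ℂ) (A + t • δ) q.2.1 q.2.2 q.1) 0 := by
  rw [deriv_V0_line_eq_sum T U τ hτ hη hd A δ]
  congr 1
  exact (Finset.sum_subset hPsub fun q hq hqP => deriv_V0p_line_eq_zero T U η (τ : 𝔸 →ₗ[ℂ] ℂ) (hP q hq hqP)).symm

/-- **THE (90)-GROUP BOUND FOR `V₀`**: under uniform majorants on `P ⊇ st(supp δA)` (`|A|(∂p) ≦ s`, `|δA|(∂p) ≦ Δ`,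
`½‖τ‖(‖U₀(∂p)‖ + ‖U₀(∂p)⁻¹‖) ≦ κ` on `P`), `|∂_{δA}V₀(A)| ≦ η^d·#P·(4/3)κη⁻¹s²e^{2ηs}Δ` (print: `#st(b) = 2(d − 1)`, `Δ` = one bond
variable; `η^d` = the weight of the pairing `⟨·,·⟩` representing (63) as a configuration). [cite: Balaban1985Variational, (90) p.291] -/
theorem norm_deriv_V0_line_le (τ : 𝔸 →L[ℂ] ℂ) (hτ : ∀ a b : 𝔸, τ (a * b) = τ (b * a)) {η : ℝ} (hη : 0 < η) {d : ℕ}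
    (hd : 4 ≤ d) (A δ : ι → S → 𝔸) {P : Finset (S × ι × ι)} (hPsub : P ⊆ posPlaq S ι)
    (hP : ∀ q ∈ posPlaq S ι, q ∉ P → lettersA T U δ q.2.1 q.2.2 q.1 = [0, 0, 0, 0]) {s Δ κ : ℝ} (hs0 : 0 < s)
    (hΔ0 : 0 < Δ) (hs : ∀ q ∈ P, size (lettersA T U A q.2.1 q.2.2 q.1) ≤ s)
    (hΔ : ∀ q ∈ P, size (lettersA T U δ q.2.1 q.2.2 q.1) ≤ Δ)
    (hκ : ∀ q ∈ P, 2⁻¹ * ‖τ‖ * (‖(plaqU T U q.2.1 q.2.2 q.1 : 𝔸)‖ + ‖(((plaqU T U q.2.1 q.2.2 q.1)⁻¹ : 𝔸ˣ) : 𝔸)‖) ≤ κ) :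
    ‖deriv (fun t : ℂ => V0 T U η d (τ : 𝔸 →ₗ[ℂ] ℂ) (A + t • δ)) 0‖
      ≤ η ^ d * (P.card * (4 / 3 * κ * η⁻¹ * s ^ 2 * Real.exp (2 * η * s) * Δ)) := by
  rw [deriv_V0_line_eq_sum_of_subset T U τ hτ hη.ne' hd A δ hPsub hP, norm_mul, norm_pow, Complex.norm_real,
    Real.norm_eq_abs, abs_of_pos hη]
  refine mul_le_mul_of_nonneg_left ?_ (by positivity)
  calc ‖∑ q ∈ P, deriv (fun t : ℂ => V0p T U η (τ : 𝔸 →ₗ[ℂ] ℂ) (A + t • δ) q.2.1 q.2.2 q.1) 0‖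
      ≤ ∑ q ∈ P, ‖deriv (fun t : ℂ => V0p T U η (τ : 𝔸 →ₗ[ℂ] ℂ) (A + t • δ) q.2.1 q.2.2 q.1) 0‖ := norm_sum_le _ _
    _ ≤ ∑ q ∈ P, 4 / 3 * κ * η⁻¹ * s ^ 2 * Real.exp (2 * η * s) * Δ := by
        refine Finset.sum_le_sum fun q hqP => ?_
        refine (norm_deriv_V0p_line_le_sq T U τ hη A δ q.2.1 q.2.2 q.1 (hs q hqP) (hΔ q hqP) hs0 hΔ0).trans ?_
        gcongr
        exact hκ q hqP
    _ = P.card * (4 / 3 * κ * η⁻¹ * s ^ 2 * Real.exp (2 * η * s) * Δ) := by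
        rw [Finset.sum_const, nsmul_eq_mul]

/-! ## §5 The sentence as printed, for `V′₀`, through the (40) majorant; the junction with `B11Eq85FirstDerivative.ineq90` -/

/-- **THE PRINTED SENTENCE, MAJORANT FORM**: an entire `g` (e.g. `t ↦ V′₀(A + tδA, ∂p)`) satisfying the first member of (40) on the
circle `|t| = s/Δ` of the line — `‖g(t)‖ ≦ (s + |t|Δ)³ηκ + (2/4!)(s + |t|Δ)⁴` (`S(t) = |A + tδA|(∂p) ≦ s + |t|Δ`;
`B11Eq37NormBound.ineq40_first` at each such `t`) — has `‖g′(0)‖ ≦ Δ(8s²ηκ + (4/3)s³)`: «a bound similar to the bound (40) …, but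
with the power of |A| lower by 1, and with a different absolute constant» (`(1, 2/4!) ↦ (8, 4/3)`).
[cite: Balaban1985Variational, (90) p.291, (40) p.284] -/
theorem norm_deriv_le_of_majorant40 {F : Type*} [NormedAddCommGroup F] [NormedSpace ℂ F] {g : ℂ → F}
    (hg : Differentiable ℂ g) {s Δ η κ : ℝ} (hs : 0 < s) (hΔ : 0 < Δ)
    (h40 : ∀ t : ℂ, ‖t‖ = s / Δ → ‖g t‖ ≤ (s + ‖t‖ * Δ) ^ 3 * η * κ + 2 / 24 * (s + ‖t‖ * Δ) ^ 4) :
    ‖deriv g 0‖ ≤ Δ * (8 * s ^ 2 * η * κ + 4 / 3 * s ^ 3) := by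
  have hr : 0 < s / Δ := div_pos hs hΔ
  have h := Complex.norm_deriv_le_of_forall_mem_sphere_norm_le (C := (2 * s) ^ 3 * η * κ + 2 / 24 * (2 * s) ^ 4) hr
    hg.diffContOnCl fun z hz => by
      rw [mem_sphere_zero_iff_norm] at hz
      have e : s + ‖z‖ * Δ = 2 * s := by rw [hz, div_mul_cancel₀ s hΔ.ne']; ring
      simpa only [e] using h40 z hz
  refine h.trans (le_of_eq ?_)
  rw [div_div_eq_mul_div, div_eq_iff hs.ne']
  ring

/-- **THE (90) JUNCTION**: the derivative majorant `g ≦ Δ(8s²ηκ + (4/3)s³)` with (32)/(57)-type data — `|A|(∂p) ≦ s ≦ 4x` (`x` = the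
sup majorant of `|A|`), `κ = K(Lʲη)⁻²` (`K = C₁B₃ε₁`, (38)), `η ≦ Lʲη = t` — gives `g ≦ 128Δ·x²(K + tx)/t`, i.e. EXACTLY the
hypothesis `hg` of `B11Eq85FirstDerivative.ineq90` with `K₀ = 128Δ`. [cite: Balaban1985Variational, (90) p.291, (40) p.284] -/
theorem hg90_of_deriv40 {g s Δ η K t x : ℝ} (hg : g ≤ Δ * (8 * s ^ 2 * η * (K / t ^ 2) + 4 / 3 * s ^ 3))
    (hΔ : 0 ≤ Δ) (hs0 : 0 ≤ s) (hsx : s ≤ 4 * x) (hK : 0 ≤ K) (ht : 0 < t) (hη0 : 0 ≤ η) (hηt : η ≤ t) :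
    g ≤ 128 * Δ * x ^ 2 * (K + t * x) / t := by
  have hx0 : 0 ≤ x := by linarith
  have hs2 : s ^ 2 ≤ 16 * x ^ 2 := by nlinarith
  have hs3 : s ^ 3 ≤ 64 * x ^ 3 := by
    have := pow_le_pow_left₀ hs0 hsx 3
    nlinarith
  have hηt2 : η / t ^ 2 ≤ 1 / t := by
    rw [div_le_div_iff₀ (by positivity) ht]
    nlinarith
  have h1 : 8 * s ^ 2 * η * (K / t ^ 2) ≤ 128 * x ^ 2 * K / t := by
    calc 8 * s ^ 2 * η * (K / t ^ 2) = 8 * s ^ 2 * K * (η / t ^ 2) := by ring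
      _ ≤ 8 * (16 * x ^ 2) * K * (1 / t) := by gcongr
      _ = 128 * x ^ 2 * K / t := by ring
  have h2 : 4 / 3 * s ^ 3 ≤ 128 * x ^ 2 * (t * x) / t := by
    have e : 128 * x ^ 2 * (t * x) / t = 128 * x ^ 3 := by field_simp
    rw [e]
    nlinarith
  calc g ≤ Δ * (8 * s ^ 2 * η * (K / t ^ 2) + 4 / 3 * s ^ 3) := hg
    _ ≤ Δ * (128 * x ^ 2 * K / t + 128 * x ^ 2 * (t * x) / t) :=
        mul_le_mul_of_nonneg_left (add_le_add h1 h2) hΔ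
    _ = 128 * Δ * x ^ 2 * (K + t * x) / t := by
        field_simp

/-- **(90) ESTIMATED FROM THE DERIVATIVE SENTENCE, BY NAME**: `B11Eq85FirstDerivative.ineq90` fed with `hg90_of_deriv40`
(`K₀ = 128Δ`): with `n = #st(b)` plaquettes, an operator bound `θ` for `𝔇*(A′)H*`, `Lʲη|A| ≦ 2ε₃` by (57), the right member of (90) is
`≦ 8n(1 + θ)·128Δ·max{C₁B₃, 1}·ε₃²(ε₁ + ε₃)(Lʲη)⁻³` — «can be estimated by O(1)ε₃²(ε₁ + ε₃)(Lʲη)⁻³ on Ω_j».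
[cite: Balaban1985Variational, (90) p.291] -/
theorem ineq90_of_deriv40 (n θ Δ C₁B₃ ε₁ ε₃ t x g s η : ℝ) (ht : 0 < t) (hn : 0 ≤ n) (hθ : 0 ≤ θ) (hΔ : 0 ≤ Δ)
    (hC : 0 ≤ C₁B₃) (hε₁ : 0 ≤ ε₁) (hx0 : 0 ≤ x) (hx : t * x ≤ 2 * ε₃) (hs0 : 0 ≤ s) (hsx : s ≤ 4 * x) (hη0 : 0 ≤ η)
    (hηt : η ≤ t) (hg : g ≤ Δ * (8 * s ^ 2 * η * (C₁B₃ * ε₁ / t ^ 2) + 4 / 3 * s ^ 3)) :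
    n * (1 + θ) * g ≤ 8 * n * (1 + θ) * (128 * Δ) * max C₁B₃ 1 * ε₃ ^ 2 * (ε₁ + ε₃) / t ^ 3 :=
  B11Eq85FirstDerivative.ineq90 n θ (128 * Δ) C₁B₃ ε₁ ε₃ t x g ht hn hθ (by positivity) hC hε₁ hx0 hx
    (hg90_of_deriv40 hg hΔ hs0 hsx (mul_nonneg hC hε₁) ht hη0 hηt)

end Literature.MathematicalPhysics.QuantumFieldTheory.Balaban1983to89.B11Eq90V0Derivative
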